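import Literature.AlgebraicGeometry.AbelianSchemes.IdealTorsionStableSubgroups
import Literature.GroupTheory.StableSubgroupsTransport
import HarnessLib

/-!
# Generic-point transport forms: the count of `𝔭`-torsion points and of `𝒪`-stable order-`q` subgroups moves along any equivariant isomorphism of
# presentations of the generic fibre ([Tate1997FiniteFlatGroupSchemes] (3.7); [GortzWedhorn2020] (4.7), (4.15))

Topic `Literature/AlgebraicGeometry/AbelianSchemes`; namespace `Literature.AlgebraicGeometry.AbelianSchemes.AbelianSchemeOver.IdealTorsion` (sequel of ★ (GF)
`IdealTorsionGenericFibreEtale`, ★ (L-q-sub) `IdealTorsionStableSubgroups`, ★ (TR) `GroupTheory.StableSubgroupsTransport`).  THEOREMS ONLY (no definition, no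
instance, no notation, no named fact, no `sorry`).  Cell `hodgecm-mathlib` (D-0151), programme P6 «MOD» (crux hLiu418 = stmt-HodgeConjecture-24832, `--supports`,
count-neutral): organ **(GP) «GENERIC-POINT TRANSPORT FORMS»** (LA1-p04 (g0) 2026-09-02 default on the GENERIC-FIBRE road; LA2-plan (g0) 02:54:37Z LS-LEAFLET §2
`natCard_lineOf_eq_succ` «LA1-p04 glue if ★»).  The D-line carrier `LineOf I y` lives on the points of `fibreΩOf … y = ((univ ×_𝓨 Y) ×_Y y)`, while the ★ dock
forms count on `((univ ×_𝓨 Spec R) ×_R Spec K)` for a valuative lift `Spec R → 𝓨` of `y`: two presentations of the SAME generic fibre, related by an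
isomorphism of abelian schemes over `Spec K` intertwining the `𝒪`-actions (★ `AbelianSchemeBaseChangeComp`), not an equality.  This file moves every count
across such an isomorphism `φ : A′ ≅ A″` (`act′.i a ≫ φ.hom = φ.hom ≫ act″.i a`): (§1) the points groups are isomorphic (`x ↦ x ≫ φ.hom`, multiplicative when
`φ.hom` is a homomorphism), the `𝔭`-torsion points are equinumerous, and so are the `LineOf`-shaped carriers {subgroups of order `r` of `𝔭`-torsion points
stable under every `ι(a)`} (★ (TR)); (§2) hence the ★ DOCK FORMS conclude at ANY presentation `A′` of the geometric generic fibre equipped with such a `φ` to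
`A ×_R Spec K`: **`#{P ∈ A′(K) | 𝔭P = 1} = dim_L Γ(G′)`** and **`#{H ≤ A′(K) | #H = q, 𝔭H = 1, ι-stable} = q + 1`** from a monomorphism `G′ ↪ A ×_R Spec L` with
the kernel-of-`𝔭` clause and `dim_L Γ(G′) = q²` (the dock՚s `hkerG₀`, `hrkG₀`).  HC_CM is proved only modulo the printed citations until rung 0 closes; this file is
generic and changes no count.

THE PRINT.  [GortzWedhorn2020] Section (4.7) (pp. 107–108) and (4.15) (p. 116): base change is functorial and transitive up to CANONICAL ISOMORPHISM
(`(X ×_S S′) ×_{S′} S″ ≅ X ×_S S″`), and points transform accordingly; [Tate1997FiniteFlatGroupSchemes] (3.7): orders and subgroup schemes of finite étale groups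
over `k̄` are read on points, hence invariant under isomorphism.

## Contents (`A′ A″ : AbelianSchemeOver S`, `act′ act″`, `φ : A′.X ≅ A″.X` with `hφ : ∀ a, act′.i a ≫ φ.hom = φ.hom ≫ act″.i a`)
* §1 `comp_i_eq_one_iff_of_iso` (`(x ≫ φ.hom) ≫ ι″(a) = 1 ↔ x ≫ ι′(a) = 1`), **`exists_mulEquiv_points_of_iso`** (`[IsMonHom φ.hom]`: `(T ⟶ A′) ≃* (T ⟶ A″)`,
  `x ↦ x ≫ φ.hom`), **`natCard_idealTorsion_points_congr`**, **`natCard_stableSubgroups_congr_of_iso`**, `exists_stableSubgroup_ne_congr_of_iso`.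
* §2 (local base `R`, `K` algebraically closed under `R` with `(N : K) ≠ 0`, `L` any `R`-field, `φ : A′.X ≅ (A ×_R Spec K).X` intertwining `act′` and
  `act_K`) **`natCard_idealTorsion_algPoints_eq_finrank_of_iso_of_forall_iff`**, **`natCard_stableSubgroups_eq_succ_of_iso_of_forall_iff`**,
  `exists_stableSubgroup_ne_of_iso_of_forall_iff`.

## References
* [GortzWedhorn2020] U. Görtz, T. Wedhorn, *Algebraic Geometry I*, 2nd ed. (2020), Section (4.7) (pp. 107–108), Section (4.15) (p. 116).
* [Tate1997FiniteFlatGroupSchemes] J. Tate, *Finite flat group schemes*, in: Modular Forms and Fermat's Last Theorem (1997), (3.7).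
* [MumfordAV1970] D. Mumford, *Abelian Varieties* (1970), §7 Thm. 4 (p. 72).
-/

set_option autoImplicit false

-- Mathlib's `Over`/`Scheme` APIs are stated across semireducible wrappers (as in ★ (S-c) and the ★ `GroupSchemes/*` base-change files).
set_option backward.isDefEq.respectTransparency false

noncomputable section

universe u

open CategoryTheory CategoryTheory.Limits AlgebraicGeometry MonoidalCategory CartesianMonoidalCategory
open scoped MonObj CategoryTheory.Obj
open Literature.AlgebraicGeometry.GroupSchemes Literature.AlgebraicGeometry.GroupSchemes.GroupSchemeKernel
open Literature.AlgebraicGeometry.GroupSchemes.AffineGroupScheme (Alg)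
open Literature.AlgebraicGeometry.Motives (SchemeOver specOver AlgPoints)

namespace Literature.AlgebraicGeometry.AbelianSchemes

namespace AbelianSchemeOver

namespace IdealTorsion

/-! ## §1 Counts move along an equivariant isomorphism of presentations -/

section Iso

variable {S : Scheme.{u}} {A' A'' : AbelianSchemeOver S} {O : Type*} [CommRing O] (act' : A'.RingAction O) (act'' : A''.RingAction O)
  (φ : A'.X ≅ A''.X) [IsMonHom φ.hom] (hφ : ∀ a, act'.i a ≫ φ.hom = φ.hom ≫ act''.i a)

omit [IsMonHom φ.hom] in
/-- Plumbing: `y ≫ φ.hom = 1 ↔ y = 1` for an isomorphism whose `hom` is a homomorphism (`1 ≫ φ.hom = 1`, ★ `MonObj.one_comp`; `φ.hom` mono).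
[cite: GortzWedhorn2020, Section (4.7) (pp. 107–108)] -/
theorem comp_hom_eq_one_iff [IsMonHom φ.hom] {T : Over S} (y : T ⟶ A'.X) : y ≫ φ.hom = 1 ↔ y = 1 := by
  constructor
  · intro h
    rw [← cancel_mono φ.hom, h, MonObj.one_comp]
  · rintro rfl
    rw [MonObj.one_comp]

include hφ in
/-- Along an intertwining isomorphism, `x ≫ φ` is killed by `ι″(a)` iff `x` is killed by `ι′(a)`. [cite: GortzWedhorn2020, Section (4.7) (pp. 107–108)] -/
theorem comp_i_eq_one_iff_of_iso {T : Over S} (x : T ⟶ A'.X) (a : O) : (x ≫ φ.hom) ≫ act''.i a = 1 ↔ x ≫ act'.i a = 1 := by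
  rw [Category.assoc, ← hφ a, ← Category.assoc, comp_hom_eq_one_iff]

/-- **THE POINTS GROUPS OF ISOMORPHIC PRESENTATIONS ARE ISOMORPHIC**: for an isomorphism `φ : A′ ≅ A″` of `S`-schemes whose `hom` is a homomorphism, `x ↦ x ≫ φ.hom`
is a group isomorphism `A′(T) ≃* A″(T)` for every `T` (★ `MonObj.mul_comp`).  With `hφ` it intertwines `(· ≫ ι′(a))` and `(· ≫ ι″(a))` — the `e` of ★ (TR).
[cite: GortzWedhorn2020, Section (4.7) (pp. 107–108) and Section (4.15) (p. 116)] -/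
theorem exists_mulEquiv_points_of_iso (T : Over S) : ∃ e : (T ⟶ A'.X) ≃* (T ⟶ A''.X), ∀ x, e x = x ≫ φ.hom :=
  ⟨{ toFun := fun x => x ≫ φ.hom
     invFun := fun y => y ≫ φ.inv
     left_inv := fun x => by simp
     right_inv := fun y => by simp
     map_mul' := fun x y => MonObj.mul_comp x y φ.hom }, fun _ => rfl⟩

include hφ in
/-- **THE `𝔭`-TORSION POINTS OF ISOMORPHIC PRESENTATIONS ARE EQUINUMEROUS** (`x ↦ x ≫ φ.hom`; `comp_i_eq_one_iff_of_iso`). [cite: Tate1997FiniteFlatGroupSchemes, (3.7)]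
[cite: GortzWedhorn2020, Section (4.7) (pp. 107–108)] -/
theorem natCard_idealTorsion_points_congr (𝔞 : Ideal O) (T : Over S) :
    Nat.card {t : T ⟶ A'.X // ∀ a ∈ 𝔞, t ≫ act'.i a = 1} = Nat.card {t : T ⟶ A''.X // ∀ a ∈ 𝔞, t ≫ act''.i a = 1} := by
  refine Nat.card_congr
    { toFun := fun t => ⟨t.1 ≫ φ.hom, fun a ha => (comp_i_eq_one_iff_of_iso act' act'' φ hφ t.1 a).2 (t.2 a ha)⟩
      invFun := fun t => ⟨t.1 ≫ φ.inv, fun a ha => (comp_i_eq_one_iff_of_iso act' act'' φ hφ (t.1 ≫ φ.inv) a).1 (by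
        simpa only [Category.assoc, Iso.inv_hom_id_assoc] using t.2 a ha)⟩
      left_inv := fun t => Subtype.ext (by simp)
      right_inv := fun t => Subtype.ext (by simp) }

include hφ in
/-- **THE `LineOf`-SHAPED CARRIERS OF ISOMORPHIC PRESENTATIONS ARE EQUINUMEROUS**: for every `r` and every ideal `𝔞`, the subgroups of `A′(T)` of order `r` made of
`𝔞`-torsion points and stable under every `ι′(a)` correspond to those of `A″(T)` (★ (TR) `StableSubgroups.natCard_stableSubgroups_congr` along the points isomorphism
of `exists_mulEquiv_points_of_iso`). [cite: Tate1997FiniteFlatGroupSchemes, (3.7)] [cite: GortzWedhorn2020, Section (4.15) (p. 116)] -/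
theorem natCard_stableSubgroups_congr_of_iso (𝔞 : Ideal O) (T : Over S) (r : ℕ) :
    Nat.card {H : Subgroup (T ⟶ A'.X) // Nat.card H = r ∧ (∀ t ∈ H, ∀ a ∈ 𝔞, t ≫ act'.i a = 1) ∧ ∀ a, ∀ t ∈ H, t ≫ act'.i a ∈ H} =
      Nat.card {H : Subgroup (T ⟶ A''.X) // Nat.card H = r ∧ (∀ t ∈ H, ∀ a ∈ 𝔞, t ≫ act''.i a = 1) ∧ ∀ a, ∀ t ∈ H, t ≫ act''.i a ∈ H} := by
  obtain ⟨e, he⟩ := exists_mulEquiv_points_of_iso φ T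
  refine Literature.GroupTheory.StableSubgroups.natCard_stableSubgroups_congr e (fun a x => x ≫ act'.i a) (fun a y => y ≫ act''.i a)
    (fun a x => ?_) (fun x => ∀ a ∈ 𝔞, x ≫ act'.i a = 1) (fun y => ∀ a ∈ 𝔞, y ≫ act''.i a = 1) (fun x => ?_) r
  · rw [he, he, Category.assoc, Category.assoc, hφ]
  · rw [he]
    exact forall₂_congr fun a _ => (comp_i_eq_one_iff_of_iso act' act'' φ hφ x a).symm

include hφ in
/-- «ANOTHER ONE» moves too: if every such carrier on `A′(T)` has a partner `≠` it, so on `A″(T)` (★ (TR) `exists_stableSubgroup_ne_congr`).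
[cite: Tate1997FiniteFlatGroupSchemes, (3.7)] -/
theorem exists_stableSubgroup_ne_congr_of_iso (𝔞 : Ideal O) (T : Over S) (r : ℕ)
    (h : ∀ H₀ : Subgroup (T ⟶ A'.X), ∃ H : Subgroup (T ⟶ A'.X),
      (Nat.card H = r ∧ (∀ t ∈ H, ∀ a ∈ 𝔞, t ≫ act'.i a = 1) ∧ ∀ a, ∀ t ∈ H, t ≫ act'.i a ∈ H) ∧ H ≠ H₀)
    (K₀ : Subgroup (T ⟶ A''.X)) :
    ∃ K : Subgroup (T ⟶ A''.X), (Nat.card K = r ∧ (∀ t ∈ K, ∀ a ∈ 𝔞, t ≫ act''.i a = 1) ∧ ∀ a, ∀ t ∈ K, t ≫ act''.i a ∈ K) ∧ K ≠ K₀ := by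
  obtain ⟨e, he⟩ := exists_mulEquiv_points_of_iso φ T
  refine Literature.GroupTheory.StableSubgroups.exists_stableSubgroup_ne_congr e (fun a x => x ≫ act'.i a) (fun a y => y ≫ act''.i a)
    (fun a x => ?_) (fun x => ∀ a ∈ 𝔞, x ≫ act'.i a = 1) (fun y => ∀ a ∈ 𝔞, y ≫ act''.i a = 1) (fun x => ?_) r h K₀
  · rw [he, he, Category.assoc, Category.assoc, hφ]
  · rw [he]
    exact forall₂_congr fun a _ => (comp_i_eq_one_iff_of_iso act' act'' φ hφ x a).symm

end Iso

/-! ## §2 The dock forms at any presentation of the geometric generic fibre -/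

section Dock

variable {R : Type u} [CommRing R] {A : AbelianSchemeOver (Spec (.of R))} {O : Type*} [CommRing O] (act : A.RingAction O) [IsCommMonObj A.X]
  {m : ℕ} (E' : Matrix (Fin m) (Fin m) O) (hE' : E' * E' = E') (P : Matrix (Fin m) (Fin 1) O) (Q : Matrix (Fin 1) (Fin m) O) {N : ℕ}

include hE' in
/-- **GENERIC-POINT DOCK FORM FOR THE TORSION COUNT**: over a local base `R`, `K` algebraically closed under `R` with `N ≠ 0` in `K`, `L` any field under `R`, a
monomorphism `ι′ : G′ ⟶ A_L` with the kernel-of-`𝔭` clause (dock `hkerG₀`), and ANY abelian scheme `A′ → Spec K` with action `act′` and an intertwining isomorphism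
`φ : A′ ≅ A_K = A ×_R Spec K` (`hom` a homomorphism): `#{P ∈ A′(K) | 𝔭P = 1} = dim_L Γ(G′, 𝒪)` (§1 + ★ (GF) `natCard_idealTorsion_algPoints_baseChange_eq_finrank_of_forall_iff`).
[cite: Tate1997FiniteFlatGroupSchemes, (3.7)] [cite: MumfordAV1970, §7 Thm. 4 (p. 72)] [cite: GortzWedhorn2020, Section (4.15) (p. 116)] -/
theorem natCard_idealTorsion_algPoints_eq_finrank_of_iso_of_forall_iff [IsLocalRing R] (hP : E' * P = P) (hQ : Q * E' = Q)
    (hQP : Q * P = Matrix.scalar (Fin 1) (N : O)) (hPQ : P * Q = Matrix.scalar (Fin m) (N : O) * E')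
    (K : Type u) [Field K] [IsAlgClosed K] [Algebra R K] (hN : (N : K) ≠ 0) (L : Type u) [Field L] [Algebra R L]
    {𝔭 : Ideal O} (h𝔭 : Ideal.span (Set.range fun k => P k 0) = 𝔭)
    {G' : SchemeOver L} [IsAffine G'.left] (ι' : G' ⟶ (A.baseChange (Spec.map (CommRingCat.ofHom (algebraMap R L)))).X) [Mono ι']
    (hG' : ∀ ⦃T : SchemeOver L⦄ (t : T ⟶ (A.baseChange (Spec.map (CommRingCat.ofHom (algebraMap R L)))).X),
      (∃ s : T ⟶ G', s ≫ ι' = t) ↔ ∀ a ∈ 𝔭, t ≫ (act.baseChange (Spec.map (CommRingCat.ofHom (algebraMap R L)))).i a = 1)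
    {A' : AbelianSchemeOver (Spec (.of K))} (act' : A'.RingAction O)
    (φ : A'.X ≅ (A.baseChange (Spec.map (CommRingCat.ofHom (algebraMap R K)))).X) [IsMonHom φ.hom]
    (hφ : ∀ a, act'.i a ≫ φ.hom = φ.hom ≫ (act.baseChange (Spec.map (CommRingCat.ofHom (algebraMap R K)))).i a) :
    Nat.card {t : AlgPoints A'.X K // ∀ a ∈ 𝔭, t ≫ act'.i a = 1} = Module.finrank L (Alg G') := by
  rw [natCard_idealTorsion_points_congr act' _ φ hφ 𝔭 (specOver K K)]
  exact natCard_idealTorsion_algPoints_baseChange_eq_finrank_of_forall_iff act E' P Q hE' hP hQ hQP hPQ K hN L h𝔭 ι' hG'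

include hE' in
/-- **GENERIC-POINT DOCK FORM FOR THE LINES COUNT — `#LineOf = q + 1` AT ANY PRESENTATION**: under the same hypotheses with `𝔭` maximal, `#(O ⧸ 𝔭) = q` finite and
`dim_L Γ(G′, 𝒪) = q²` (dock `hrkG₀`), EXACTLY `q + 1` subgroups of `A′(K)` of order `q` consist of `𝔭`-torsion points and are `ι′`-stable (§1 + ★ (L-q-sub)
`natCard_stableSubgroups_baseChange_eq_succ_of_forall_iff`).  For the D-line: `A′ := (univ ×_𝓨 Y) ×_Y y` (the presentation `fibreΩOf … y` of `LineOf I y`), `φ` the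
★ `AbelianSchemeBaseChangeComp` isomorphism to `(univ ×_𝓨 Spec R) ×_R Spec Ω` for a valuative lift of `y`.
[cite: Tate1997FiniteFlatGroupSchemes, (3.7)] [cite: MumfordAV1970, §7 Thm. 4 (p. 72)] [cite: GortzWedhorn2020, Section (4.15) (p. 116)] -/
theorem natCard_stableSubgroups_eq_succ_of_iso_of_forall_iff [IsLocalRing R] (hP : E' * P = P) (hQ : Q * E' = Q)
    (hQP : Q * P = Matrix.scalar (Fin 1) (N : O)) (hPQ : P * Q = Matrix.scalar (Fin m) (N : O) * E')
    (K : Type u) [Field K] [IsAlgClosed K] [Algebra R K] (hN : (N : K) ≠ 0) (L : Type u) [Field L] [Algebra R L]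
    {𝔭 : Ideal O} [𝔭.IsMaximal] [Finite (O ⧸ 𝔭)] (h𝔭 : Ideal.span (Set.range fun k => P k 0) = 𝔭)
    {G' : SchemeOver L} [IsAffine G'.left] (ι' : G' ⟶ (A.baseChange (Spec.map (CommRingCat.ofHom (algebraMap R L)))).X) [Mono ι']
    (hG' : ∀ ⦃T : SchemeOver L⦄ (t : T ⟶ (A.baseChange (Spec.map (CommRingCat.ofHom (algebraMap R L)))).X),
      (∃ s : T ⟶ G', s ≫ ι' = t) ↔ ∀ a ∈ 𝔭, t ≫ (act.baseChange (Spec.map (CommRingCat.ofHom (algebraMap R L)))).i a = 1)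
    (hrk : Module.finrank L (Alg G') = Nat.card (O ⧸ 𝔭) ^ 2)
    {A' : AbelianSchemeOver (Spec (.of K))} (act' : A'.RingAction O)
    (φ : A'.X ≅ (A.baseChange (Spec.map (CommRingCat.ofHom (algebraMap R K)))).X) [IsMonHom φ.hom]
    (hφ : ∀ a, act'.i a ≫ φ.hom = φ.hom ≫ (act.baseChange (Spec.map (CommRingCat.ofHom (algebraMap R K)))).i a) :
    Nat.card {H : Subgroup (AlgPoints A'.X K) // Nat.card H = Nat.card (O ⧸ 𝔭) ∧
        (∀ t ∈ H, ∀ a ∈ 𝔭, t ≫ act'.i a = 1) ∧ ∀ a, ∀ t ∈ H, t ≫ act'.i a ∈ H} = Nat.card (O ⧸ 𝔭) + 1 := by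
  rw [natCard_stableSubgroups_congr_of_iso act' _ φ hφ 𝔭 (specOver K K)]
  exact natCard_stableSubgroups_baseChange_eq_succ_of_forall_iff act E' hE' P Q hP hQ hQP hPQ K hN L h𝔭 ι' hG' hrk

include hE' in
/-- **«ANOTHER LINE» AT ANY PRESENTATION** (the `htwo`∕`hthree`-type feeds): under the hypotheses of `natCard_stableSubgroups_eq_succ_of_iso_of_forall_iff`, for every
`H₀ ≤ A′(K)` there is an `ι′`-stable subgroup `H ≠ H₀` of order `q` of `𝔭`-torsion points (`q + 1 ≥ 2` of them). [cite: Tate1997FiniteFlatGroupSchemes, (3.7)] -/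
theorem exists_stableSubgroup_ne_of_iso_of_forall_iff [IsLocalRing R] (hP : E' * P = P) (hQ : Q * E' = Q)
    (hQP : Q * P = Matrix.scalar (Fin 1) (N : O)) (hPQ : P * Q = Matrix.scalar (Fin m) (N : O) * E')
    (K : Type u) [Field K] [IsAlgClosed K] [Algebra R K] (hN : (N : K) ≠ 0) (L : Type u) [Field L] [Algebra R L]
    {𝔭 : Ideal O} [𝔭.IsMaximal] [Finite (O ⧸ 𝔭)] (h𝔭 : Ideal.span (Set.range fun k => P k 0) = 𝔭)
    {G' : SchemeOver L} [IsAffine G'.left] (ι' : G' ⟶ (A.baseChange (Spec.map (CommRingCat.ofHom (algebraMap R L)))).X) [Mono ι']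
    (hG' : ∀ ⦃T : SchemeOver L⦄ (t : T ⟶ (A.baseChange (Spec.map (CommRingCat.ofHom (algebraMap R L)))).X),
      (∃ s : T ⟶ G', s ≫ ι' = t) ↔ ∀ a ∈ 𝔭, t ≫ (act.baseChange (Spec.map (CommRingCat.ofHom (algebraMap R L)))).i a = 1)
    (hrk : Module.finrank L (Alg G') = Nat.card (O ⧸ 𝔭) ^ 2)
    {A' : AbelianSchemeOver (Spec (.of K))} (act' : A'.RingAction O)
    (φ : A'.X ≅ (A.baseChange (Spec.map (CommRingCat.ofHom (algebraMap R K)))).X) [IsMonHom φ.hom]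
    (hφ : ∀ a, act'.i a ≫ φ.hom = φ.hom ≫ (act.baseChange (Spec.map (CommRingCat.ofHom (algebraMap R K)))).i a)
    (H₀ : Subgroup (AlgPoints A'.X K)) :
    ∃ H : Subgroup (AlgPoints A'.X K), (Nat.card H = Nat.card (O ⧸ 𝔭) ∧
        (∀ t ∈ H, ∀ a ∈ 𝔭, t ≫ act'.i a = 1) ∧ ∀ a, ∀ t ∈ H, t ≫ act'.i a ∈ H) ∧ H ≠ H₀ := by
  have h := natCard_stableSubgroups_eq_succ_of_iso_of_forall_iff act E' hE' P Q hP hQ hQP hPQ K hN L h𝔭 ι' hG' hrk act' φ hφ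
  haveI : Finite {H : Subgroup (AlgPoints A'.X K) // Nat.card H = Nat.card (O ⧸ 𝔭) ∧
      (∀ t ∈ H, ∀ a ∈ 𝔭, t ≫ act'.i a = 1) ∧ ∀ a, ∀ t ∈ H, t ≫ act'.i a ∈ H} :=
    Nat.finite_of_card_ne_zero (by rw [h]; exact Nat.succ_ne_zero _)
  have h2 : 1 < Nat.card {H : Subgroup (AlgPoints A'.X K) // Nat.card H = Nat.card (O ⧸ 𝔭) ∧
      (∀ t ∈ H, ∀ a ∈ 𝔭, t ≫ act'.i a = 1) ∧ ∀ a, ∀ t ∈ H, t ≫ act'.i a ∈ H} := by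
    rw [h]
    have : Nat.card (O ⧸ 𝔭) ≠ 0 := Nat.card_pos.ne'
    omega
  obtain ⟨H₁, H₂, hne⟩ := (Finite.one_lt_card_iff_nontrivial.1 h2).exists_pair_ne
  by_cases h₁ : H₁.1 = H₀
  · exact ⟨H₂.1, H₂.2, fun h₂ => hne (Subtype.ext (h₁.trans h₂.symm))⟩
  · exact ⟨H₁.1, H₁.2, h₁⟩

end Dock

/-! ## §3 (ED. 2) The kernel-of-`𝔭` clause moves along an equivariant isomorphism: the dock datum at any presentation of the special fibre -/

section Clause

variable {S : Scheme.{u}} {A' A'' : AbelianSchemeOver S} {O : Type*} [CommRing O] (act' : A'.RingAction O) (act'' : A''.RingAction O)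
  (φ : A'.X ≅ A''.X) [IsMonHom φ.hom] (hφ : ∀ a, act'.i a ≫ φ.hom = φ.hom ≫ act''.i a)

include hφ in
/-- **THE KERNEL-OF-`𝔭` CLAUSE TRANSPORTS**: if `ι′ : G′ ⟶ A′` has the kernel-of-`𝔭` clause for `act′` on `T`-points (the dock row `hkerG₀`, read with `Iff.symm`),
then `ι′ ≫ φ.hom : G′ ⟶ A″` has it for `act″` — so the D-line dock `(G₀, ι₀G, hkerG₀, hrkG₀)` at `x̄`, given on the presentation `(univ ×_𝓨 𝓨_s) ×_{𝓨_s} x̄` of the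
special fibre, serves as the `(G′, ι′, hG′)` input of the ★ dock forms at the presentation `(univ ×_𝓨 Spec R) ×_R Spec κ̄` along the ★ `AbelianSchemeBaseChangeComp`
isomorphism (`Mono (ι′ ≫ φ.hom)` is automatic). [cite: GortzWedhorn2020, Section (4.15) (p. 116) and Definition 4.45 (2), p. 117] [cite: Tate1997FiniteFlatGroupSchemes, (3.7)] -/
theorem forall_exists_comp_iff_of_iso {𝔞 : Ideal O} {G' : Over S} (ι' : G' ⟶ A'.X)
    (hG' : ∀ ⦃T : Over S⦄ (t : T ⟶ A'.X), (∃ s : T ⟶ G', s ≫ ι' = t) ↔ ∀ a ∈ 𝔞, t ≫ act'.i a = 1) ⦃T : Over S⦄ (t : T ⟶ A''.X) :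
    (∃ s : T ⟶ G', s ≫ (ι' ≫ φ.hom) = t) ↔ ∀ a ∈ 𝔞, t ≫ act''.i a = 1 := by
  have ht : t = (t ≫ φ.inv) ≫ φ.hom := by simp
  constructor
  · rintro ⟨s, rfl⟩ a ha
    have h1 : (s ≫ ι') ≫ act'.i a = 1 := ((hG' (s ≫ ι')).1 ⟨s, rfl⟩) a ha
    have h2 := (comp_i_eq_one_iff_of_iso act' act'' φ hφ (s ≫ ι') a).2 h1
    simpa only [Category.assoc] using h2
  · intro h
    have h' : ∀ a ∈ 𝔞, (t ≫ φ.inv) ≫ act'.i a = 1 := fun a ha =>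
      (comp_i_eq_one_iff_of_iso act' act'' φ hφ (t ≫ φ.inv) a).1 (by rw [← ht]; exact h a ha)
    obtain ⟨s, hs⟩ := (hG' (t ≫ φ.inv)).2 h'
    exact ⟨s, by rw [← Category.assoc, hs, Category.assoc, φ.inv_hom_id, Category.comp_id]⟩

omit [IsMonHom φ.hom] in
/-- The rank input moves trivially: `Γ(G′)` is unchanged (the SAME `G′` serves; only its structure map to `A″` is composed with `φ`) — recorded for the consumer՚s
checklist: `hrk : dim_L Γ(G′) = q²` is used verbatim. [cite: Tate1997FiniteFlatGroupSchemes, (3.7)] -/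
theorem mono_comp_hom_of_iso {G' : Over S} (ι' : G' ⟶ A'.X) [Mono ι'] : Mono (ι' ≫ φ.hom) := mono_comp _ _

end Clause


end IdealTorsion

end AbelianSchemeOver

end Literature.AlgebraicGeometry.AbelianSchemes

end
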